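import Literature.Analysis.FluidPDE.CompressibleEulerImplosionODEContinuation
import HarnessLib

/-!
# Buckmaster–Cao-Labora–Gómez-Serrano: maximal solutions leave every compact set

Topic `Literature/Analysis/FluidPDE`; namespace
`Literature.Analysis.FluidPDE.BuckmasterCaolaboraGomezserrano2025.ODE`. Companion of
`CompressibleEulerImplosion.lean` (named fact `BuckmasterCaolaboraGomezserrano2025_thm11_monatomic`,
THEOREM 1.1 of T. Buckmaster, G. Cao-Labora, J. Gómez-Serrano, *Smooth imploding solutions for 3D
compressible fluids*, Forum Math. Pi 13 (2025) e6, arXiv:2208.09445); sequel of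
`CompressibleEulerImplosionODEContinuation.lean` (uniform existence time, extension past the
endpoint).

Brick A-esc of the discharge plan: the escape principle for the autonomous system `c′ = F(c)`
with `F` of class `C¹` on an open set `U` — if a solution on `(a, T)` with values in `U` returns
to a fixed compact `K ⊆ U` at times arbitrarily close to `T`, then it extends to a `U`-valued
solution on a strictly longer interval (`exists_extend_of_frequently_mem`); contrapositively, a
solution admitting no `U`-valued extension eventually leaves every compact subset of `U`
(`eventually_not_mem_of_maximal`). This is the form in which "the trajectory is bounded, hence
converges to the boundary point `P_s`" is used in the proof of Proposition 2.5 (and in Prop. 3.1).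
Theorems only, folklore. [cite: BuckmasterCaolaboraGomezserrano2025, Prop. 2.5 (proof), Prop. 1.6]
-/

noncomputable section

open Set Filter Metric Topology

namespace Literature.Analysis.FluidPDE

namespace BuckmasterCaolaboraGomezserrano2025

namespace ODE

variable {E : Type*} [NormedAddCommGroup E] [NormedSpace ℝ E] {F : E → E} {U : Set E}

/-- **Escape lemma, positive form.** Let `F` be `C¹` on the open set `U`, `K ⊆ U` compact, and
let `c` solve `c′ = F(c)` on `(a, T)` with values in `U`. If `c` visits `K` at times arbitrarily
close to `T`, then `c` extends to a `U`-valued solution on some `(a, T')` with `T' > T`. [folklore] -/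
theorem exists_extend_of_frequently_mem [CompleteSpace E] (hU : IsOpen U)
    (hF : ∀ x ∈ U, ContDiffAt ℝ 1 F x) {K : Set E} (hK : IsCompact K) (hKU : K ⊆ U)
    {c : ℝ → E} {a T : ℝ} (hc : ∀ t ∈ Ioo a T, HasDerivAt c (F (c t)) t)
    (hcU : ∀ t ∈ Ioo a T, c t ∈ U)
    (hfreq : ∀ δ > (0 : ℝ), ∃ t ∈ Ioo a T, T - δ < t ∧ c t ∈ K) :
    ∃ c' : ℝ → E, ∃ T' : ℝ, T < T' ∧ EqOn c' c (Ioo a T) ∧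
      (∀ t ∈ Ioo a T', HasDerivAt c' (F (c' t)) t) ∧ ∀ t ∈ Ioo a T', c' t ∈ U := by
  obtain ⟨ε, hε, Hε⟩ := exists_uniform_time hF hK hKU
  obtain ⟨t₁, ht₁, hTt₁, hK₁⟩ := hfreq (ε / 2) (by linarith)
  obtain ⟨c', hc'eq, hc'⟩ := exists_extend (F := F) Hε le_rfl ht₁ (by linarith) hc
    (fun t ht => hF _ (hcU t ht)) hK₁
  -- `c' T ∈ K`: `c'` is continuous at `T` and `c' = c` visits `K` at times `→ T`
  have hT₁ : T ∈ Ioo a (t₁ + ε) := ⟨ht₁.1.trans ht₁.2, by linarith⟩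
  have hcont : ContinuousAt c' T := (hc' T hT₁).continuousAt
  have hmemK : c' T ∈ K := by
    rw [← hK.isClosed.closure_eq, Metric.mem_closure_iff]
    intro e he
    obtain ⟨δ, hδ, hδe⟩ := Metric.continuousAt_iff.mp hcont e he
    obtain ⟨t, ht, hTt, htK⟩ := hfreq δ hδ
    refine ⟨c t, htK, ?_⟩
    have hdist : dist t T < δ := by
      rw [Real.dist_eq, abs_sub_lt_iff]; constructor <;> linarith [ht.2]
    have := hδe hdist
    rw [hc'eq ht] at this
    rwa [dist_comm]
  -- `c'` stays in the open set `U` for a while after `T`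
  have hUn : ∀ᶠ t in 𝓝 T, c' t ∈ U := hcont.preimage_mem_nhds (hU.mem_nhds (hKU hmemK))
  obtain ⟨ρ, hρ, hρU⟩ := Metric.eventually_nhds_iff.mp hUn
  refine ⟨c', min (T + ρ) (t₁ + ε), lt_min (by linarith) (by linarith), hc'eq, fun t ht =>
    hc' t ⟨ht.1, lt_of_lt_of_le ht.2 (min_le_right _ _)⟩, fun t ht => ?_⟩
  rcases lt_or_ge t T with h | h
  · rw [hc'eq ⟨ht.1, h⟩]; exact hcU t ⟨ht.1, h⟩
  · apply hρU
    have : t < T + ρ := lt_of_lt_of_le ht.2 (min_le_left _ _)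
    rw [Real.dist_eq, abs_sub_lt_iff]; constructor <;> linarith

/-- **Escape lemma.** Let `F` be `C¹` on the open set `U` and let `c` solve `c′ = F(c)` on `(a, T)`
with values in `U`, admitting no `U`-valued extension to a longer interval `(a, T')`. Then `c`
eventually leaves every compact `K ⊆ U`: there is `δ > 0` with `c t ∉ K` for `T − δ < t < T`.
[folklore] -/
theorem eventually_not_mem_of_maximal [CompleteSpace E] (hU : IsOpen U)
    (hF : ∀ x ∈ U, ContDiffAt ℝ 1 F x) {K : Set E} (hK : IsCompact K) (hKU : K ⊆ U)
    {c : ℝ → E} {a T : ℝ} (hc : ∀ t ∈ Ioo a T, HasDerivAt c (F (c t)) t)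
    (hcU : ∀ t ∈ Ioo a T, c t ∈ U)
    (hmax : ∀ (c' : ℝ → E) (T' : ℝ), T < T' → EqOn c' c (Ioo a T) →
      (∀ t ∈ Ioo a T', HasDerivAt c' (F (c' t)) t) → ¬ ∀ t ∈ Ioo a T', c' t ∈ U) :
    ∃ δ > (0 : ℝ), ∀ t ∈ Ioo a T, T - δ < t → c t ∉ K := by
  by_contra hcon
  have hfreq : ∀ δ > (0 : ℝ), ∃ t ∈ Ioo a T, T - δ < t ∧ c t ∈ K := fun δ hδ => by
    by_contra h'
    refine hcon ⟨δ, hδ, fun t ht hTt htK => h' ⟨t, ht, hTt, htK⟩⟩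
  obtain ⟨c', T', hT', heq, hc', hc'U⟩ :=
    exists_extend_of_frequently_mem hU hF hK hKU hc hcU hfreq
  exact hmax c' T' hT' heq hc' hc'U

end ODE

end BuckmasterCaolaboraGomezserrano2025

end Literature.Analysis.FluidPDE
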